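import Summits.HodgeConjecture.CorCM.WeilFourfoldOfMarkmanPlane
import Summits.HodgeConjecture.CorCM.Model.CMAbelianVarietyRealisedHolds
import Literature.AlgebraicGeometry.HodgeTheory.WeilClassesEllipticExchangePair
import Literature.NumberTheory.ComplexMultiplication.CMTypeCount
import HarnessLib

/-!
# COR-CM — Weil classes of a product of TWO CM threefolds over one imaginary quadratic field, given Markman's
# fourfold theorem: the multiplicity dictionary of a CM-type realisation and the pair elliptic exchange

Cell `pub-hodgecm2` (COR-CM = stage 2 of the Hodge ladder), seat b30 gen 13 (2026-08-21); COUNT-NEUTRAL (no row of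
`HOME/BINDER-OWNERS.md`); theorems only, no definition, no named fact, no `sorry`.  Sequel of the seat's Literature
lemma `HodgeTheory.weilClassesOf_threefold_prod_threefold_le_algebraicClasses_of_markman`
(`Literature/AlgebraicGeometry/HodgeTheory/WeilClassesEllipticExchangePair.lean`): the Weil plane of a product of two
threefolds `(Z₁, χ₁)`, `(Z₂, χ₂)` with `K = ℚ(√-d)`-multiplicities `1` and `2` (of `i√d` on `H^{1,0}`) is algebraic GIVEN
`Markman2025_weilClasses_algebraic_abelianFourfold`, via the elliptic completions `Z₁ × E`, `Z₂ × Ē` by a `K`-curve of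
multiplicity `1`.  Here the multiplicities are READ OFF CM TYPES.

* §1 THE DICTIONARY (any number field `K`, any realisation `A ⊨ (K; Φ)` = `IsCMTypeRealisation Φ A ι θ`):
  `hodgeOneZero_eq_span` — `H^{1,0}(A) = ⟨v_σ : σ ∈ Φ⟩` for an eigenbasis `(v_σ)_{σ : K → ℂ}` of `H¹(A(ℂ); ℂ)`;
  `eigenspace_map_ι_eq_span` — `ker(ι(a)^* − μ) = ⟨v_σ : σ(a) = μ⟩`;
  **`finrank_eigenspace_inf_hodgeOneZero_eq_card` — the multiplicity of `μ` on `H^{1,0}(A)` under `ι(a)^*` is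
  `#{σ ∈ Φ : σ(a) = μ}`** (Shimura–Taniyama: `ι(a)^*` acts on the `σ`-eigenline by `σ(a)`, and the `σ`-eigenline
  is of type `(1,0)` iff `σ ∈ Φ`).
* §2 `comp_eq_iff_apply_eq` — for a quadratic `k`, `i : k → K`, `δ ∈ 𝓞_k` with `δ² = -d < 0` and `τ(δ) = i√d`:
  `s ∘ i = τ ⟺ s(iδ) = i√d` (`Hom(k, ℂ) = {τ, τ̄}`), so the multiplicity of `i√d` for `ι(iδ)` is the TYPE COUNT
  `#{s ∈ Ψ : s ∘ i = τ}` over the fibre of `τ` (`finrank_eigenspace_inf_hodgeOneZero_eq_card_fibre`), and for a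
  `k`-curve `E ⊨ (k; Φ₀)` it is `[τ ∈ Φ₀]`.
* §3 **`weilClassesOf_prod_le_algebraicClasses_of_markman`** — for realisations `B₁ ⊨ (K₁; Ψ₁)`, `B₂ ⊨ (K₂; Ψ₂)`
  (`[K₁:ℚ] = [K₂:ℚ] = 6`, the two sextic fields MAY DIFFER), `E ⊨ (k; Φ₀)` (`[k:ℚ] = 2`), ring maps `i₁ : k → K₁`,
  `i₂ : k → K₂`, `δ ∈ 𝓞_k` with `δ² = -d`, `d ≥ 1`, `τ(δ) = i√d`, and TYPE COUNTS `#{s ∈ Ψ₁ : s ∘ i₁ = τ} = 1`,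
  `#{s ∈ Ψ₂ : s ∘ i₂ = τ} = 2`, `τ ∈ Φ₀`: **the whole Weil plane
  `weilClassesOf (B₁ × B₂) (ι₁(i₁δ) × ι₂(i₂δ)) 3 d` — the `k`-Weil line `⋀⁶_k H¹(B₁ × B₂)` tensored with `ℂ`, a plane
  of Hodge `(3,3)`-classes on a CM abelian SIXFOLD — consists of algebraic classes, GIVEN Markman's fourfold theorem
  only.**  `E` is auxiliary (any CM curve of `k` of the right type; the tree's `cmAbelianVarietyRealised_holds`
  supplies one) and does not occur in the conclusion.

WHY (count-neutral content for the ladder's «what is open»).  The Galois-sextic rung (`CorCM/CyclicSextic*`, seat b30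
gens 11–12) needs `IsGalois ℚ K`; for a NON-Galois sextic CM field `K = k·F₀` (normal closure of degree `12`) the
primitive CM types give THREE pairwise non-isogenous Galois-conjugate simple threefolds `B₁, B₂, B₃` with `k ⊂ End⁰`,
and §3 (with `K₁ = K₂ = K`, `i₁ = i₂`) makes the `k`-Weil `(3,3)`-classes of every `Bₘ × Bₘ'` (conjugate `k`-structure
on one factor) algebraic modulo Markman — the first classes on these products beyond divisors and the fourfolds
`Bₘ × E`.  (Seat note, HOME/pub-hodgecm2-b30: the `K`-Weil line of `B₁ × B₂ × B₃ × E`, the PerL-shaped rank-four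
face of `K`, is NOT in the span of divisor and quadratic-Weil weights — outside this mechanism and outside the degree
clause `[L:ℚ] ∈ {24, 48}` of `Universe.PerL`.)

## References
* [Markman2025SurveySecant] E. Markman, arXiv:2509.23403, Thm. 1.2, §11.5 Step 2 (the displayed hypothesis).
* [Shimura1998] G. Shimura, *Abelian Varieties with Complex Multiplication and Modular Functions* (1998), §5.2
  (the CM type on `H^{1,0}`), §6.2 Thm. 3.
* [vanGeemen1994HodgeAV] B. van Geemen, LNM 1594 (1994), 4.9 (multiplicities), Lemma 5.2.
* [Deligne1982HodgeCycles] P. Deligne (notes by J. S. Milne), LNM 900 (1982), §5 (c) (sums of CM types, Weil type).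
* [Schoen1998HodgeWeilAddendum] C. Schoen, Compositio Math. 114 (1998), §10.
-/

noncomputable section

namespace Summit.HodgeConjecture.CorCM.CMThreefoldPair

open CategoryTheory CategoryTheory.Limits NumberField
open Literature.AlgebraicGeometry Literature.AlgebraicGeometry.Motives Literature.AlgebraicGeometry.HodgeTheory
open Literature.AlgebraicGeometry.ComplexMultiplication (IsCMTypeRealisation)
open Literature.AlgebraicTopology.SingularHomology
open Literature.NumberTheory.Automorphic.PicardCM (eigenline)
open Summit.HodgeConjecture.CorCM.AndreProductForm
  (exists_eigenbasis map_ι_apply_of_mem_eigenline isOfHodgeType_oneZero_of_mem isOfHodgeType_zeroOne_of_not_mem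
    dim_eq_of_isCMTypeRealisation)
open Summit.HodgeConjecture.CorCM.WeilFourfold (comp_self_eq_neg_of_sq_eq_neg)

/-! ## §1 The multiplicity dictionary of a CM-type realisation -/

section Dictionary

open scoped Classical

variable {K : Type} [Field K] [NumberField K] {Φ : CMType K} {A : AbelianVariety ℂ} {ι : 𝓞 K →+* End A}
  {θ : K →+* Module.End ℂ (complexBetti A.X 1)}

/-- Two parts of a basis span subspaces meeting in the span of the common part. [folklore] -/
theorem span_image_inf_span_image {J : Type*} (b : Module.Basis J ℂ (complexBetti A.X 1)) (s t : Set J) :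
    Submodule.span ℂ (b '' s) ⊓ Submodule.span ℂ (b '' t) = Submodule.span ℂ (b '' (s ∩ t)) := by
  refine le_antisymm (fun x hx ↦ ?_) (le_inf (Submodule.span_mono (Set.image_mono Set.inter_subset_left))
    (Submodule.span_mono (Set.image_mono Set.inter_subset_right)))
  rw [b.mem_span_image, Set.subset_inter_iff]
  exact ⟨b.mem_span_image.1 hx.1, b.mem_span_image.1 hx.2⟩

/-- The span of the basis vectors indexed by a set `s` has dimension `#s`. [folklore] -/
theorem finrank_span_image_eq_card {J : Type*} [Fintype J] (b : Module.Basis J ℂ (complexBetti A.X 1)) (s : Set J) :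
    Module.finrank ℂ (Submodule.span ℂ (b '' s)) = (Finset.univ.filter fun j => j ∈ s).card := by
  have hli : LinearIndependent ℂ (fun x : s => b x) := b.linearIndependent.comp _ Subtype.val_injective
  rw [Set.image_eq_range, finrank_span_eq_card hli]
  convert Fintype.card_subtype (fun j => j ∈ s) using 1

/-- The `σ`-eigenvectors for `σ ∈ Φ` lie in `H^{1,0}(A)` (in any normalisation of the dimension). [cite: Shimura1998, §5.2] -/
theorem mem_hodgeOneZero_of_mem_eigenline (hA : IsCMTypeRealisation Φ A ι θ) {n : ℕ}
    (hX : IsSmoothProjective n A.X) {σ : K →+* ℂ} {v : complexBetti A.X 1} (hv : v ∈ eigenline θ σ)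
    (hσ : σ ∈ Φ.1) : v ∈ hodgeOneZero hX := by
  have h := (isOfHodgeType_oneZero_of_mem hA hv hσ).map_of_isSmoothProjective hX
    AbelianVariety.isSmoothProjective_holds (𝟙 A.X)
  rwa [complexBetti.map_id] at h

/-- The `σ`-eigenvectors for `σ ∉ Φ` lie in `H^{0,1}(A)`. [cite: Shimura1998, §5.2] -/
theorem mem_hodgeZeroOne_of_mem_eigenline (hA : IsCMTypeRealisation Φ A ι θ) {n : ℕ}
    (hX : IsSmoothProjective n A.X) {σ : K →+* ℂ} {v : complexBetti A.X 1} (hv : v ∈ eigenline θ σ)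
    (hσ : σ ∉ Φ.1) : v ∈ hodgeZeroOne hX := by
  have h := (isOfHodgeType_zeroOne_of_not_mem hA hv hσ).map_of_isSmoothProjective hX
    AbelianVariety.isSmoothProjective_holds (𝟙 A.X)
  rwa [complexBetti.map_id] at h

/-- **`H^{1,0}(A) = ⟨v_σ : σ ∈ Φ⟩`** for an eigenbasis `(v_σ)` of `H¹(A(ℂ); ℂ)` of a realisation of `(K; Φ)`: the
`v_σ`, `σ ∈ Φ`, are of type `(1,0)`, the others of type `(0,1)`, and `H¹ = H^{1,0} ⊕ H^{0,1}`.
[cite: Shimura1998, §5.2] [cite: vanGeemen1994HodgeAV, 4.9] -/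
theorem hodgeOneZero_eq_span (hA : IsCMTypeRealisation Φ A ι θ) {n : ℕ} (hX : IsSmoothProjective n A.X)
    (v : Module.Basis (K →+* ℂ) ℂ (complexBetti A.X 1)) (hv : ∀ σ, v σ ∈ eigenline θ σ) :
    hodgeOneZero hX = Submodule.span ℂ (v '' Φ.1) := by
  have h10 : Submodule.span ℂ (v '' Φ.1) ≤ hodgeOneZero hX := by
    rw [Submodule.span_le]
    rintro _ ⟨σ, hσ, rfl⟩
    exact mem_hodgeOneZero_of_mem_eigenline hA hX (hv σ) hσ
  have h01 : Submodule.span ℂ (v '' Φ.1ᶜ) ≤ hodgeZeroOne hX := by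
    rw [Submodule.span_le]
    rintro _ ⟨σ, hσ, rfl⟩
    exact mem_hodgeZeroOne_of_mem_eigenline hA hX (hv σ) hσ
  refine le_antisymm (fun x hx ↦ ?_) h10
  have htop : x ∈ Submodule.span ℂ (v '' Φ.1) ⊔ Submodule.span ℂ (v '' Φ.1ᶜ) := by
    rw [← Submodule.span_union, ← Set.image_union, Set.union_compl_self, Set.image_univ, v.span_eq]
    exact Submodule.mem_top
  obtain ⟨y, hy, z, hz, rfl⟩ := Submodule.mem_sup.1 htop
  have hz10 : z ∈ hodgeOneZero hX := by
    have h := Submodule.sub_mem _ hx (h10 hy)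
    rwa [add_sub_cancel_left] at h
  have hz0 : z = 0 :=
    Submodule.disjoint_def.1 (isCompl_hodgeOneZero_hodgeZeroOne hX).disjoint z hz10 (h01 hz)
  rw [hz0, add_zero]
  exact hy

/-- **`ker(ι(a)^* − μ) = ⟨v_σ : σ(a) = μ⟩` on `H¹(A(ℂ); ℂ)`**: `ι(a)^*` is diagonal in the eigenbasis with
eigenvalues `σ(a)`. [cite: Shimura1998, §5.2] -/
theorem eigenspace_map_ι_eq_span (hA : IsCMTypeRealisation Φ A ι θ)
    (v : Module.Basis (K →+* ℂ) ℂ (complexBetti A.X 1)) (hv : ∀ σ, v σ ∈ eigenline θ σ) (a : 𝓞 K) (μ : ℂ) :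
    Module.End.eigenspace (complexBetti.map (ι a).hom.hom.hom 1).hom μ =
      Submodule.span ℂ (v '' {σ | σ (a : K) = μ}) := by
  ext x
  rw [Module.End.mem_eigenspace_iff]
  have h := forall_apply_eq_smul_iff_mem_span_image (P := Unit) v
    (fun _ => (complexBetti.map (ι a).hom.hom.hom 1).hom) (fun σ _ => σ (a : K))
    (fun _ σ => map_ι_apply_of_mem_eigenline hA (hv σ) a) (fun _ => μ) x
  have hset : {σ : K →+* ℂ | (fun _ : Unit => σ (a : K)) = fun _ => μ} = {σ | σ (a : K) = μ} := by
    ext σ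
    simp only [Set.mem_setOf_eq]
    exact ⟨fun h => congrFun h (), fun h => funext fun _ => h⟩
  rw [hset] at h
  exact ⟨fun hx => h.1 fun _ => hx, fun hx => (h.2 hx) ()⟩

/-- **The multiplicity dictionary** (Shimura–Taniyama; van Geemen 4.9 read on a CM abelian variety): for a
realisation `A ⊨ (K; Φ)` and `a ∈ 𝓞_K`, the multiplicity of the eigenvalue `μ` of `ι(a)^*` on `H^{1,0}(A)` is the
TYPE COUNT `#{σ ∈ Φ : σ(a) = μ}`. [cite: Shimura1998, §5.2] [cite: vanGeemen1994HodgeAV, 4.9] -/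
theorem finrank_eigenspace_inf_hodgeOneZero_eq_card (hA : IsCMTypeRealisation Φ A ι θ) {n : ℕ}
    (hX : IsSmoothProjective n A.X) (a : 𝓞 K) (μ : ℂ) :
    Module.finrank ℂ ↥(Module.End.eigenspace (complexBetti.map (ι a).hom.hom.hom 1).hom μ ⊓ hodgeOneZero hX) =
      (Finset.univ.filter fun σ : K →+* ℂ => σ (a : K) = μ ∧ σ ∈ Φ.1).card := by
  obtain ⟨v, hv⟩ := exists_eigenbasis hA
  rw [eigenspace_map_ι_eq_span hA v hv a μ, hodgeOneZero_eq_span hA hX v hv, span_image_inf_span_image,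
    finrank_span_image_eq_card]
  congr 1
  ext σ
  simp only [Finset.mem_filter, Finset.mem_univ, true_and, Set.mem_inter_iff, Set.mem_setOf_eq]

end Dictionary

/-! ## §2 The fibre of an embedding of an imaginary quadratic field -/

section Quadratic

open scoped Classical

variable {K : Type} [Field K] [NumberField K] {k : Type} [Field k] [NumberField k]

/-- `-(i√d) ≠ i√d` for `d ≥ 1`. [folklore] -/
theorem neg_I_mul_sqrt_ne {d : ℕ} (hd : 0 < d) :
    -(Complex.I * (Real.sqrt d : ℂ)) ≠ Complex.I * (Real.sqrt d : ℂ) := by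
  intro h
  have hs : (Real.sqrt d : ℂ) ≠ 0 := by
    rw [Ne, Complex.ofReal_eq_zero]
    exact (Real.sqrt_pos.2 (Nat.cast_pos.2 hd)).ne'
  have h2 : (2 : ℂ) * (Complex.I * (Real.sqrt d : ℂ)) = 0 := by linear_combination -h
  exact (mul_ne_zero two_ne_zero (mul_ne_zero Complex.I_ne_zero hs)) h2

omit [NumberField k] in
/-- For `δ ∈ 𝓞_k` with `τ(δ) = i√d`, `d ≥ 1`: the conjugate embedding has `τ̄(δ) = -i√d ≠ i√d`, so `τ̄ ≠ τ`.
[folklore] -/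
theorem conjugate_ne_of_apply_eq {δ : 𝓞 k} {d : ℕ} (hd : 0 < d) {τ : k →+* ℂ}
    (hτ : τ (δ : k) = Complex.I * (Real.sqrt d : ℂ)) : ComplexEmbedding.conjugate τ ≠ τ := by
  intro h
  have h1 : ComplexEmbedding.conjugate τ (δ : k) = τ (δ : k) := by rw [h]
  rw [ComplexEmbedding.conjugate_coe_eq, hτ, map_mul, Complex.conj_I, Complex.conj_ofReal, neg_mul] at h1
  exact neg_I_mul_sqrt_ne hd h1

/-- **An embedding of a quadratic field is determined by its value on `δ`**: with `[k:ℚ] = 2`, `δ² = -d`, `d ≥ 1`,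
`τ(δ) = i√d`, every `τ' : k → ℂ` with `τ'(δ) = i√d` equals `τ` (`Hom(k, ℂ) = {τ, τ̄}` and `τ̄(δ) = -i√d`). [folklore] -/
theorem eq_of_apply_eq (h2 : Module.finrank ℚ k = 2) {δ : 𝓞 k} {d : ℕ} (hd : 0 < d) {τ τ' : k →+* ℂ}
    (hτ : τ (δ : k) = Complex.I * (Real.sqrt d : ℂ)) (hτ' : τ' (δ : k) = Complex.I * (Real.sqrt d : ℂ)) :
    τ' = τ := by
  by_contra hne
  -- `τ' ≠ τ̄`: `τ̄(δ) = -i√d ≠ i√d = τ'(δ)`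
  have hne' : τ' ≠ ComplexEmbedding.conjugate τ := by
    intro h
    have h1 : τ' (δ : k) = ComplexEmbedding.conjugate τ (δ : k) := by rw [h]
    rw [ComplexEmbedding.conjugate_coe_eq, hτ, hτ', map_mul, Complex.conj_I, Complex.conj_ofReal, neg_mul] at h1
    exact neg_I_mul_sqrt_ne hd h1.symm
  -- three pairwise distinct embeddings of a quadratic field: impossible
  have hτc : ComplexEmbedding.conjugate τ ∉ ({τ'} : Finset (k →+* ℂ)) := by
    rw [Finset.mem_singleton]; exact fun h => hne' h.symm
  have hτi : τ ∉ (insert (ComplexEmbedding.conjugate τ) {τ'} : Finset (k →+* ℂ)) := by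
    simp only [Finset.mem_insert, Finset.mem_singleton, not_or]
    exact ⟨(conjugate_ne_of_apply_eq hd hτ).symm, Ne.symm hne⟩
  have h3 : (insert τ (insert (ComplexEmbedding.conjugate τ) {τ'}) : Finset (k →+* ℂ)).card = 3 := by
    rw [Finset.card_insert_of_notMem hτi, Finset.card_insert_of_notMem hτc, Finset.card_singleton]
  have hcard : Fintype.card (k →+* ℂ) = 2 := by rw [Embeddings.card, h2]
  have h4 := Finset.card_le_univ (insert τ (insert (ComplexEmbedding.conjugate τ) {τ'}) : Finset (k →+* ℂ))
  rw [h3, hcard] at h4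
  omega

omit [NumberField K] in
/-- **`s ∘ i = τ ⟺ s(iδ) = i√d`** for `i : k → K`, `s : K → ℂ` (`[k:ℚ] = 2`, `δ² = -d`, `d ≥ 1`, `τ(δ) = i√d`).
[folklore] -/
theorem comp_eq_iff_apply_eq (h2 : Module.finrank ℚ k = 2) (i : k →+* K) {δ : 𝓞 k} {d : ℕ} (hd : 0 < d)
    {τ : k →+* ℂ} (hτ : τ (δ : k) = Complex.I * (Real.sqrt d : ℂ)) (s : K →+* ℂ) :
    s.comp i = τ ↔ s ((RingOfIntegers.mapRingHom i δ : 𝓞 K) : K) = Complex.I * (Real.sqrt d : ℂ) := by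
  rw [RingOfIntegers.mapRingHom_apply, ← RingHom.comp_apply]
  exact ⟨fun h => by rw [h, hτ], fun h => eq_of_apply_eq h2 hd hτ h⟩

variable {Ψ : CMType K} {B : AbelianVariety ℂ} {ιB : 𝓞 K →+* End B} {θB : K →+* Module.End ℂ (complexBetti B.X 1)}

/-- **Multiplicity = type count over the fibre**: for `B ⊨ (K; Ψ)`, `i : k → K` (`[k:ℚ] = 2`), `δ² = -d`, `τ(δ) = i√d`,
the multiplicity of `i√d` on `H^{1,0}(B)` under `ι_B(iδ)^*` is `#{s ∈ Ψ : s ∘ i = τ}`.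
[cite: Shimura1998, §5.2] [cite: vanGeemen1994HodgeAV, 4.9] -/
theorem finrank_eigenspace_inf_hodgeOneZero_eq_card_fibre (hB : IsCMTypeRealisation Ψ B ιB θB) {n : ℕ}
    (hX : IsSmoothProjective n B.X) (h2 : Module.finrank ℚ k = 2) (i : k →+* K) {δ : 𝓞 k} {d : ℕ} (hd : 0 < d)
    {τ : k →+* ℂ} (hτ : τ (δ : k) = Complex.I * (Real.sqrt d : ℂ)) :
    Module.finrank ℂ ↥(Module.End.eigenspace
        (complexBetti.map (ιB (RingOfIntegers.mapRingHom i δ)).hom.hom.hom 1).hom (Complex.I * (Real.sqrt d : ℂ)) ⊓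
        hodgeOneZero hX) =
      (Finset.univ.filter fun s : K →+* ℂ => s.comp i = τ ∧ s ∈ Ψ.1).card := by
  rw [finrank_eigenspace_inf_hodgeOneZero_eq_card hB hX]
  congr 1
  refine Finset.filter_congr fun s _ => ?_
  rw [comp_eq_iff_apply_eq h2 i hd hτ s]

variable {Φ₀ : CMType k} {E : AbelianVariety ℂ} {ιE : 𝓞 k →+* End E} {θE : k →+* Module.End ℂ (complexBetti E.X 1)}

/-- **Multiplicity of a `k`-curve**: for `E ⊨ (k; Φ₀)` (`[k:ℚ] = 2`), `δ² = -d`, `τ(δ) = i√d`, the multiplicity of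
`i√d` on `H^{1,0}(E)` under `ι_E(δ)^*` is `1` if `τ ∈ Φ₀` (and `0` otherwise). [cite: Shimura1998, §5.2]
[cite: vanGeemen1994HodgeAV, 4.9 and 5.7] -/
theorem finrank_eigenspace_inf_hodgeOneZero_eq_one_of_mem (hE : IsCMTypeRealisation Φ₀ E ιE θE) {n : ℕ}
    (hX : IsSmoothProjective n E.X) (h2 : Module.finrank ℚ k = 2) {δ : 𝓞 k} {d : ℕ} (hd : 0 < d)
    {τ : k →+* ℂ} (hτ : τ (δ : k) = Complex.I * (Real.sqrt d : ℂ)) (hτΦ : τ ∈ Φ₀.1) :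
    Module.finrank ℂ ↥(Module.End.eigenspace (complexBetti.map (ιE δ).hom.hom.hom 1).hom
        (Complex.I * (Real.sqrt d : ℂ)) ⊓ hodgeOneZero hX) = 1 := by
  rw [finrank_eigenspace_inf_hodgeOneZero_eq_card hE hX, Finset.card_eq_one]
  refine ⟨τ, Finset.ext fun σ => ?_⟩
  simp only [Finset.mem_filter, Finset.mem_univ, true_and, Finset.mem_singleton]
  exact ⟨fun h => eq_of_apply_eq h2 hd hτ h.1, fun h => by subst h; exact ⟨hτ, hτΦ⟩⟩

end Quadratic

/-! ## §3 Two CM threefolds over one imaginary quadratic field -/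

section Pair

open scoped Classical

variable {K₁ : Type} [Field K₁] [NumberField K₁] {K₂ : Type} [Field K₂] [NumberField K₂]
  {k : Type} [Field k] [NumberField k]
  {Ψ₁ : CMType K₁} {B₁ : AbelianVariety ℂ} {ι₁ : 𝓞 K₁ →+* End B₁} {θ₁ : K₁ →+* Module.End ℂ (complexBetti B₁.X 1)}
  {Ψ₂ : CMType K₂} {B₂ : AbelianVariety ℂ} {ι₂ : 𝓞 K₂ →+* End B₂} {θ₂ : K₂ →+* Module.End ℂ (complexBetti B₂.X 1)}
  {Φ₀ : CMType k} {E : AbelianVariety ℂ} {ιE : 𝓞 k →+* End E} {θE : k →+* Module.End ℂ (complexBetti E.X 1)}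

omit [NumberField k] in
/-- `δ² = -d` in `𝓞_k` from `δ² = -d` in `k`. [folklore] -/
theorem sq_eq_neg_ringOfIntegers {δ : 𝓞 k} {d : ℕ} (hδ : ((δ : k)) ^ 2 = -(d : k)) : δ ^ 2 = -(d : 𝓞 k) := by
  apply RingOfIntegers.ext
  change algebraMap (𝓞 k) k (δ ^ 2) = algebraMap (𝓞 k) k (-(d : 𝓞 k))
  rw [map_pow, map_neg, map_natCast]
  exact hδ

/-- **Weil classes of a product of two CM threefolds over one imaginary quadratic field, given Markman's fourfold
theorem.**  Realisations `B₁ ⊨ (K₁; Ψ₁)`, `B₂ ⊨ (K₂; Ψ₂)` of CM types of two SEXTIC fields (possibly different),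
`E ⊨ (k; Φ₀)` of a QUADRATIC field, ring maps `i₁ : k → K₁`, `i₂ : k → K₂`, `δ ∈ 𝓞_k` with `δ² = -d`, `d ≥ 1`, and
`τ : k → ℂ` with `τ(δ) = i√d`; `k` acts on `B₁ × B₂` by `φ := ι₁(i₁δ) × ι₂(i₂δ)`.  If the TYPE COUNTS over the fibre of
`τ` are `#{s ∈ Ψ₁ : s ∘ i₁ = τ} = 1`, `#{s ∈ Ψ₂ : s ∘ i₂ = τ} = 2` and `τ ∈ Φ₀` — i.e. `(B₁, k)` is of type `(1,2)`,
`(B₂, k)` of type `(2,1)`, `(E, k)` of type `(1,0)` — then the WHOLE Weil plane `weilClassesOf (B₁ × B₂) φ 3 d`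
(`= W_k(B₁ × B₂) ⊗ ℂ`, Hodge `(3,3)`-classes on a CM sixfold) consists of algebraic classes.  Proof: the
multiplicity dictionary (§§1–2) and the Literature lemma
`weilClassesOf_threefold_prod_threefold_le_algebraicClasses_of_markman` (elliptic completions `B₁ × E`, `B₂ × Ē` are
Weil-type FOURFOLDS, algebraic by Markman; product step, regrouping and one Schoen descent along `E × Ē`).  The
curve `E` does not occur in the conclusion.  CONDITIONAL only on the displayed named fact
`Markman2025_weilClasses_algebraic_abelianFourfold`. [cite: Markman2025SurveySecant, Thm. 1.2 and §11.5 Step 2]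
[cite: Deligne1982HodgeCycles, §5 (c)] [cite: Schoen1998HodgeWeilAddendum, §10] [cite: vanGeemen1994HodgeAV, 4.9]
[cite: Shimura1998, §5.2] -/
theorem weilClassesOf_prod_le_algebraicClasses_of_markman
    (hW4 : Markman2025_weilClasses_algebraic_abelianFourfold)
    (h6₁ : Module.finrank ℚ K₁ = 6) (h6₂ : Module.finrank ℚ K₂ = 6) (h2 : Module.finrank ℚ k = 2)
    (i₁ : k →+* K₁) (i₂ : k →+* K₂)
    (hB₁ : IsCMTypeRealisation Ψ₁ B₁ ι₁ θ₁) (hB₂ : IsCMTypeRealisation Ψ₂ B₂ ι₂ θ₂)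
    (hE : IsCMTypeRealisation Φ₀ E ιE θE)
    {δ : 𝓞 k} {d : ℕ} (hd : 0 < d) (hδ : ((δ : k)) ^ 2 = -(d : k))
    {τ : k →+* ℂ} (hτ : τ (δ : k) = Complex.I * (Real.sqrt d : ℂ))
    (hc₁ : (Finset.univ.filter fun s : K₁ →+* ℂ => s.comp i₁ = τ ∧ s ∈ Ψ₁.1).card = 1)
    (hc₂ : (Finset.univ.filter fun s : K₂ →+* ℂ => s.comp i₂ = τ ∧ s ∈ Ψ₂.1).card = 2)
    (hτΦ : τ ∈ Φ₀.1) :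
    weilClassesOf (B₁.prod B₂)
        (AbelianVariety.prodLift (AbelianVariety.fst B₁ B₂ ≫ ι₁ (RingOfIntegers.mapRingHom i₁ δ))
          (AbelianVariety.snd B₁ B₂ ≫ ι₂ (RingOfIntegers.mapRingHom i₂ δ))) 3 d ≤
      algebraicClasses (B₁.prod B₂).X 3 := by
  -- dimensions
  have hB₁3 : B₁.dim = 3 := by rw [dim_eq_of_isCMTypeRealisation hB₁, h6₁]
  have hB₂3 : B₂.dim = 3 := by rw [dim_eq_of_isCMTypeRealisation hB₂, h6₂]
  have hE1 : E.dim = 1 := by rw [dim_eq_of_isCMTypeRealisation hE, h2]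
  -- squares
  have hδ𝓞 : δ ^ 2 = -(d : 𝓞 k) := sq_eq_neg_ringOfIntegers hδ
  have hδ₁ : (RingOfIntegers.mapRingHom i₁ δ) ^ 2 = -(d : 𝓞 K₁) := by rw [← map_pow, hδ𝓞, map_neg, map_natCast]
  have hδ₂ : (RingOfIntegers.mapRingHom i₂ δ) ^ 2 = -(d : 𝓞 K₂) := by rw [← map_pow, hδ𝓞, map_neg, map_natCast]
  have hχ₁ := comp_self_eq_neg_of_sq_eq_neg ι₁ hδ₁
  have hχ₂ := comp_self_eq_neg_of_sq_eq_neg ι₂ hδ₂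
  have hψ₀ := comp_self_eq_neg_of_sq_eq_neg ιE hδ𝓞
  -- multiplicities from the CM types
  have hm₁ := finrank_eigenspace_inf_hodgeOneZero_eq_card_fibre hB₁ (isSmoothProjective_of_dim_eq' hB₁3) h2 i₁ hd hτ
  rw [hc₁] at hm₁
  have hm₂ := finrank_eigenspace_inf_hodgeOneZero_eq_card_fibre hB₂ (isSmoothProjective_of_dim_eq' hB₂3) h2 i₂ hd hτ
  rw [hc₂] at hm₂
  have hmE := finrank_eigenspace_inf_hodgeOneZero_eq_one_of_mem hE (isSmoothProjective_of_dim_eq' hE1) h2 hd hτ hτΦ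
  exact weilClassesOf_threefold_prod_threefold_le_algebraicClasses_of_markman hW4 hd hB₁3 hB₂3 hE1 hχ₁ hχ₂ hψ₀
    hm₁ hm₂ hmE

/-- **One sextic field** (the shape used for the Galois-conjugate threefolds of a NON-Galois sextic CM field
`K ⊇ i(k)`): two realisations `B₁ ⊨ (K; Ψ₁)`, `B₂ ⊨ (K; Ψ₂)` of CM types of the SAME sextic field with fibre counts
`1` and `2` over `τ` — the Weil plane of `(B₁ × B₂, ι₁(iδ) × ι₂(iδ))` is algebraic, given Markman's fourfold theorem.
[cite: Markman2025SurveySecant, Thm. 1.2 and §11.5 Step 2] [cite: Deligne1982HodgeCycles, §5 (c)] -/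
theorem weilClassesOf_prod_le_algebraicClasses_of_markman_sameField
    (hW4 : Markman2025_weilClasses_algebraic_abelianFourfold)
    {Ψ₁' : CMType K₁} {B₂' : AbelianVariety ℂ} {ι₂' : 𝓞 K₁ →+* End B₂'}
    {θ₂' : K₁ →+* Module.End ℂ (complexBetti B₂'.X 1)}
    (h6 : Module.finrank ℚ K₁ = 6) (h2 : Module.finrank ℚ k = 2) (i : k →+* K₁)
    (hB₁ : IsCMTypeRealisation Ψ₁ B₁ ι₁ θ₁) (hB₂ : IsCMTypeRealisation Ψ₁' B₂' ι₂' θ₂')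
    (hE : IsCMTypeRealisation Φ₀ E ιE θE)
    {δ : 𝓞 k} {d : ℕ} (hd : 0 < d) (hδ : ((δ : k)) ^ 2 = -(d : k))
    {τ : k →+* ℂ} (hτ : τ (δ : k) = Complex.I * (Real.sqrt d : ℂ))
    (hc₁ : (Finset.univ.filter fun s : K₁ →+* ℂ => s.comp i = τ ∧ s ∈ Ψ₁.1).card = 1)
    (hc₂ : (Finset.univ.filter fun s : K₁ →+* ℂ => s.comp i = τ ∧ s ∈ Ψ₁'.1).card = 2)
    (hτΦ : τ ∈ Φ₀.1) :
    weilClassesOf (B₁.prod B₂')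
        (AbelianVariety.prodLift (AbelianVariety.fst B₁ B₂' ≫ ι₁ (RingOfIntegers.mapRingHom i δ))
          (AbelianVariety.snd B₁ B₂' ≫ ι₂' (RingOfIntegers.mapRingHom i δ))) 3 d ≤
      algebraicClasses (B₁.prod B₂').X 3 :=
  weilClassesOf_prod_le_algebraicClasses_of_markman hW4 h6 h6 h2 i i hB₁ hB₂ hE hd hδ hτ hc₁ hc₂ hτΦ

end Pair

/-! ## §4 (v2, seat b30 gen 13) The curve-free form (`E ⊨ (k; {τ})` from `cmAbelianVarietyRealised_holds`) -/

section CurveFree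

open scoped Classical
open Literature.NumberTheory.ComplexMultiplication (CMTypeCount.single CMTypeCount.single_val)
variable {K₁ : Type} [Field K₁] [NumberField K₁] {K₂ : Type} [Field K₂] [NumberField K₂]
  {k : Type} [Field k] [NumberField k] [IsCMField k]
  {Ψ₁ : CMType K₁} {B₁ : AbelianVariety ℂ} {ι₁ : 𝓞 K₁ →+* End B₁} {θ₁ : K₁ →+* Module.End ℂ (complexBetti B₁.X 1)}
  {Ψ₂ : CMType K₂} {B₂ : AbelianVariety ℂ} {ι₂ : 𝓞 K₂ →+* End B₂} {θ₂ : K₂ →+* Module.End ℂ (complexBetti B₂.X 1)}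

/-- **Weil classes of a product of two CM threefolds over one imaginary quadratic field `k` (a CM field with
`[k:ℚ] = 2`), given Markman's fourfold theorem — curve-free form.**  Realisations `B₁ ⊨ (K₁; Ψ₁)`, `B₂ ⊨ (K₂; Ψ₂)`
of CM types of two sextic fields, `i₁ : k → K₁`, `i₂ : k → K₂`, `δ ∈ 𝓞_k` with `δ² = -d`, `d ≥ 1`, `τ(δ) = i√d`,
type counts `#{s ∈ Ψ₁ : s ∘ i₁ = τ} = 1` and `#{s ∈ Ψ₂ : s ∘ i₂ = τ} = 2`: the whole Weil plane
`weilClassesOf (B₁ × B₂) (ι₁(i₁δ) × ι₂(i₂δ)) 3 d` consists of algebraic classes (the auxiliary curve of §3 is the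
tree's realisation of the CM type `{τ}` of `k`: `cmAbelianVarietyRealised_holds`, `CMTypeCount.single`).  CONDITIONAL
only on `Markman2025_weilClasses_algebraic_abelianFourfold`. [cite: Markman2025SurveySecant, Thm. 1.2 and §11.5 Step 2]
[cite: Shimura1998, §6.2 Theorem 3 and §8.4 Example (1)] [cite: Deligne1982HodgeCycles, §5 (c)] -/
theorem weilClassesOf_prod_le_algebraicClasses_of_markman_curveFree
    (hW4 : Markman2025_weilClasses_algebraic_abelianFourfold)
    (h6₁ : Module.finrank ℚ K₁ = 6) (h6₂ : Module.finrank ℚ K₂ = 6) (h2 : Module.finrank ℚ k = 2)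
    (i₁ : k →+* K₁) (i₂ : k →+* K₂)
    (hB₁ : IsCMTypeRealisation Ψ₁ B₁ ι₁ θ₁) (hB₂ : IsCMTypeRealisation Ψ₂ B₂ ι₂ θ₂)
    {δ : 𝓞 k} {d : ℕ} (hd : 0 < d) (hδ : ((δ : k)) ^ 2 = -(d : k))
    {τ : k →+* ℂ} (hτ : τ (δ : k) = Complex.I * (Real.sqrt d : ℂ))
    (hc₁ : (Finset.univ.filter fun s : K₁ →+* ℂ => s.comp i₁ = τ ∧ s ∈ Ψ₁.1).card = 1)
    (hc₂ : (Finset.univ.filter fun s : K₂ →+* ℂ => s.comp i₂ = τ ∧ s ∈ Ψ₂.1).card = 2) :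
    weilClassesOf (B₁.prod B₂)
        (AbelianVariety.prodLift (AbelianVariety.fst B₁ B₂ ≫ ι₁ (RingOfIntegers.mapRingHom i₁ δ))
          (AbelianVariety.snd B₁ B₂ ≫ ι₂ (RingOfIntegers.mapRingHom i₂ δ))) 3 d ≤
      algebraicClasses (B₁.prod B₂).X 3 := by
  obtain ⟨E, ιE, θE, hE⟩ := cmAbelianVarietyRealised_holds k (CMTypeCount.single h2 τ)
  exact weilClassesOf_prod_le_algebraicClasses_of_markman hW4 h6₁ h6₂ h2 i₁ i₂ hB₁ hB₂ (Φ₀ := CMTypeCount.single h2 τ)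
    hE hd hδ hτ hc₁ hc₂ (by rw [CMTypeCount.single_val]; exact Set.mem_singleton τ)
end CurveFree

end Summit.HodgeConjecture.CorCM.CMThreefoldPair

end
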